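import Mathlib
import HarnessLib
import Literature.MathematicalPhysics.QuantumLattice.GrassmannEffectiveActionBiGradedMap
import Summits.HubbardSuperconductivity.HubbardSuperconductivity.Theorems.KLProgrammeKLRegimeEngineScaleZeroNormsL1

/-!
# K3 engine child (stmt-HubbardSuperconductivity-19855), stub `stub_engine_scale0`, clause (E1-v4)₀: the scale-`0` norm bound through the
# BI-GRADED determinant-bounded step (`p - 1` powers of the QUARTIC size)

Cell gate-hubbard-kl, seat hubbard-kl-k3c2-p1.  Siblings of `KLProgrammeKLRegimeEngineScaleZeroNormsL1` (`…_of_gridStep_l1`, `…_of_frameOK_l1`,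
`…_of_symbol_bounds_l1`) in which the graded step `θ^{p-2}/(1-θ)` (θ mixing the quadratic counterterm size `(β/N)·kK` with the quartic
size `|U|β/N`) is replaced by the bi-graded step of `Literature/…/GrassmannEffectiveActionBiGradedMap`
(`kernelNorm_kernel_map_effAction_le_biquartic_of_gramBounded`): `e f₂ θ₂^{p-2}/(1-θ)^p` with `f₂ = (e²(κ+ρ))⁴·|U|β/N` and
`θ₂ = eαf₂/κ²` — the degree-`2p` kernel carries `p - 1` powers of `|U|` whatever the size `kK` of the counterterm's position kernel
(which is NOT `O(U)` deep in the regime: `kK ≲ Gfr2·U²·nScales`), the quadratic part entering only `(1-θ)^{-p}`.  This is the form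
the clause `KernelNormsV4 … 0` (`CE^p (Klam·U)^{p-1}`) needs.

* `klAnisoLegKernelNorm_zero_le_of_gridStep_bi`, `klAnisoLegKernelNorm_zero_le_of_frameOK_bi`,
  **`klAnisoLegKernelNorm_zero_le_of_symbol_bounds_bi`**.

Everything is proved (same proofs with the bi-graded step); no definitions, no named facts, no sorry.
-/

noncomputable section

namespace Summit.HubbardSuperconductivity.HubbardSuperconductivity.Theorems.EngineV8

set_option linter.dupNamespace false -- summit = problem name (single-conjunct summit), D-0017

open Real Finset Literature.MathematicalPhysics.QuantumLattice Literature.Probability.LatticeModels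
open Literature.MathematicalPhysics.QuantumLattice.GrassmannAlgebra
open Summit.HubbardSuperconductivity.HubbardSuperconductivity.Theorems.KLRegimeSplit
open Summit.HubbardSuperconductivity.HubbardSuperconductivity.Theorems.DispersionFlow
open Summit.HubbardSuperconductivity.HubbardSuperconductivity.Theorems.KLProgrammeLegKernels
open Summit.HubbardSuperconductivity.HubbardSuperconductivity.Theorems.TorusFourierL2
open scoped ComplexConjugate

variable {L M : ℕ} [NeZero L]

/-- **The scale-`0` anisotropic-sector kernel norms from ONE degree-graded determinant-bounded step** (stub `stub_engine_scale0`,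
clause (E1-v4)₀, modulo the three sizes α, Br, Bc).  Let `S = hubbardGridSub L M β (4M)`, `C₀ = C^K_{>e₀} = hubbardCovAboveCT … 0 K klE0`,
`E₀ = sectorAnalysisMatrix β (klAnisoFamily … klE0 0)`.  If `SᵀC₀S` is replica-Gram-bounded with constant `κ > 0` and has row and
column sums `≤ α`, if `θ = eα‖Ṽ‖_h/κ² < 1` for the grid vertex's pinned profile and a weight `ρ > 0`, and if the
cross-grid overlap kernel `E₀S` has row sizes `≤ Br` and column sizes `≤ Bc`, then for every `p ≥ 2`
`klAnisoLegKernelNorm … klE0 0 (2p) ≤ Br · Bc^{2p-1} · (β/(2M))^{2p-1} · (ρ^{-2p} · e‖Ṽ‖_h · θ^{p-2}/(1 - θ))`. -/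
theorem klAnisoLegKernelNorm_zero_le_of_gridStep_bi [NeZero M] {β : ℝ} (hβ : 0 < β) (U μ : ℝ) (K : TrigPolyC4v) {kK : ℝ}
    (hkK : ∑ z : TorusSite 2 L, ‖framePosKernel L K z‖ ≤ kK) {κ : ℝ} (hκ : 0 < κ)
    (hGB : IsGramBoundedR ((hubbardGridSub L M β (2 * (2 * M))).transpose * hubbardCovAboveCT L M β μ 0 K klE0 *
      hubbardGridSub L M β (2 * (2 * M))) κ)
    {α : ℝ} (hα : 0 < α)
    (hrow : ∀ X, ∑ Y, ‖((hubbardGridSub L M β (2 * (2 * M))).transpose * hubbardCovAboveCT L M β μ 0 K klE0 *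
      hubbardGridSub L M β (2 * (2 * M))) X Y‖ ≤ α)
    (hcol : ∀ Y, ∑ X, ‖((hubbardGridSub L M β (2 * (2 * M))).transpose * hubbardCovAboveCT L M β μ 0 K klE0 *
      hubbardGridSub L M β (2 * (2 * M))) X Y‖ ≤ α)
    {ρ : ℝ} (hρ : 0 < ρ)
    (hθ : Real.exp 1 * α * normV (GridLeg (GridPoint L (2 * (2 * M)))) κ ρ ((fun m' : ℕ => if m' = 1 then |β| / (2 * (2 * M) : ℕ) * kK else if m' = 2 then |U| * |β| / (2 * (2 * M) : ℕ) else 0)) / κ ^ 2 < 1)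
    {Br Bc : ℝ} (hBr0 : 0 ≤ Br) (hBc0 : 0 ≤ Bc)
    (hBr : ∀ (ω : Fin (sectorCount 0)) (σ c : Fin 2) (y : SpaceTimeIdx L M),
      ∑ q : GridPoint L (2 * (2 * M)),
        ‖(sectorAnalysisMatrix L M β (klAnisoFamily L M β μ K klE0 0) * hubbardGridSub L M β (2 * (2 * M)))
          (y, ((ω, σ), c)) ((q, σ), c)‖ ≤ Br)
    (hBc : ∀ (σ c : Fin 2) (q : GridPoint L (2 * (2 * M))),
      ∑ ω : Fin (sectorCount 0), ∑ y : SpaceTimeIdx L M,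
        ‖(sectorAnalysisMatrix L M β (klAnisoFamily L M β μ K klE0 0) * hubbardGridSub L M β (2 * (2 * M)))
          (y, ((ω, σ), c)) ((q, σ), c)‖ ≤ Bc)
    {p : ℕ} (hp : 2 ≤ p) :
    klAnisoLegKernelNorm L M β U μ K klE0 0 (2 * p) ≤
      Br * Bc ^ (2 * p - 1) * imagTimeWeight β M ^ (2 * p - 1) *
        (ρ⁻¹ ^ (2 * p) * (Real.exp 1 * ((Real.exp 2 * (κ + ρ)) ^ (2 * 2) * (|U| * |β| / (2 * (2 * M) : ℕ)))) *
          (Real.exp 1 * α * ((Real.exp 2 * (κ + ρ)) ^ (2 * 2) * (|U| * |β| / (2 * (2 * M) : ℕ))) / κ ^ 2) ^ (p - 2) /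
            (1 - Real.exp 1 * α * normV (GridLeg (GridPoint L (2 * (2 * M)))) κ ρ ((fun m' : ℕ => if m' = 1 then |β| / (2 * (2 * M) : ℕ) * kK else if m' = 2 then |U| * |β| / (2 * (2 * M) : ℕ) else 0)) / κ ^ 2) ^ p) := by
  -- notation
  set Ng : ℕ := 2 * (2 * M) with hNg
  set S := hubbardGridSub L M β Ng with hS
  set C₀ := hubbardCovAboveCT L M β μ 0 K klE0 with hC₀
  set F₀ := klAnisoFamily L M β μ K klE0 0 with hF₀
  set E₀ := sectorAnalysisMatrix L M β F₀ with hE₀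
  set Vt := hubbardGridInteraction L Ng β U + hubbardGridCounterQuadratic L Ng β K with hVt
  have hp0 : 0 < 2 * p := by omega
  have hfS : LinearMap.toMatrix' (Matrix.toLin' S) = S := LinearMap.toMatrix'_toLin' S
  have hgE : LinearMap.toMatrix' (Matrix.toLin' E₀) = E₀ := LinearMap.toMatrix'_toLin' E₀
  -- (1) the sectorised norm of `𝒱^{(0)}` through the analysis map
  have h1 : klAnisoLegKernelNorm L M β U μ K klE0 0 (2 * p) ≤
      kernelNorm (imagTimeWeight β M) (2 * p)
        (kernel ℂ (ExteriorAlgebra.map (Matrix.toLin' E₀)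
          (effAction ℂ C₀ (ExteriorAlgebra.map (Matrix.toLin' S) Vt))) (2 * p)) := by
    rw [klAnisoLegKernelNorm, klEffectiveAction_zero_eq_effAction_map hβ.ne' U μ K]
    exact hubbardSectorKernelNorm_le_kernelNorm_map_of_pos hβ.le F₀ hp0 _ _
  -- (2) the graded representation theorem
  have hVt_even : Vt ∈ evenPart ℂ (GridLeg (GridPoint L Ng)) :=
    add_mem (hubbardGridInteraction_mem_evenPart β U) (hubbardGridCounterQuadratic_mem_evenPart β K)
  have hVt0 : constPart ℂ Vt = 0 := by
    rw [hVt, map_add, constPart_hubbardGridInteraction, constPart_hubbardGridCounterQuadratic, add_zero]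
  have hN2 : ∀ m', 2 < m' → (fun m' : ℕ => if m' = 1 then |β| / Ng * kK else if m' = 2 then |U| * |β| / Ng else 0) m' = 0 :=
    fun m' hm' => by simp [show m' ≠ 1 by omega, show m' ≠ 2 by omega]
  have h2 := (kernelNorm_kernel_map_effAction_le_biquartic_of_gramBounded C₀ (Matrix.toLin' S) (Matrix.toLin' E₀) Vt hVt_even
    hVt0 (fun m' : ℕ => if m' = 1 then |β| / Ng * kK else if m' = 2 then |U| * |β| / Ng else 0) (scaleZeroPinnedL1_nonneg β U (le_trans (sum_nonneg fun _ _ => norm_nonneg _) hkK) Ng) (sum_norm_kernel_gridVertex_le_l1 β U K hkK)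
    hN2 hκ (by rw [hfS]; exact hGB) hα (by rw [hfS]; exact hrow) (by rw [hfS]; exact hcol) hρ hθ
    hBr0 hBc0 (fun X'' => by rw [hfS, hgE]; exact rowSum_sectorAnalysis_mul_gridSub_le β F₀ _ _ hBr X'')
    (fun X' => by rw [hfS, hgE]; exact colSum_sectorAnalysis_mul_gridSub_le β F₀ _ _ hBc X')
    (imagTimeWeight_nonneg hβ.le M) hp).2
  exact h1.trans h2


/-- **(E1-v4)₀ for every admissible frame, modulo the three sizes**: at the tree's `M`-, `β`-uniform scale-`0` Gram constant
`κ₀ = √(2(7+6047))` (`isGramBoundedR_scaleZero_of_frameOK_sharp`, `FrameOK R U N μ K`, `klBetaMin ≤ β ≤ L`) and weight `ρ = κ₀`,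
for every `p ≥ 2`: `klAnisoLegKernelNorm … klE0 0 (2p) ≤ Br · Bc^{2p-1} · (β/(2M))^{2p-1} · (κ₀^{-2p} e‖Ṽ‖_h θ^{p-2}/(1-θ))`,
`θ = eα‖Ṽ‖_h/κ₀²`. -/
theorem klAnisoLegKernelNorm_zero_le_of_frameOK_bi [NeZero M] {R : RenConsts} {U : ℝ} {N : ℕ} {μ : ℝ} {K : TrigPolyC4v}
    (hK : FrameOK R U N μ K) {β : ℝ} (hβ : klBetaMin ≤ β) (hβL : β ≤ L) {kK : ℝ}
    (hkK : ∑ z : TorusSite 2 L, ‖framePosKernel L K z‖ ≤ kK)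
    {α : ℝ} (hα : 0 < α)
    (hrow : ∀ X, ∑ Y, ‖((hubbardGridSub L M β (2 * (2 * M))).transpose * hubbardCovAboveCT L M β μ 0 K klE0 *
      hubbardGridSub L M β (2 * (2 * M))) X Y‖ ≤ α)
    (hcol : ∀ Y, ∑ X, ‖((hubbardGridSub L M β (2 * (2 * M))).transpose * hubbardCovAboveCT L M β μ 0 K klE0 *
      hubbardGridSub L M β (2 * (2 * M))) X Y‖ ≤ α)
    (hθ : Real.exp 1 * α * normV (GridLeg (GridPoint L (2 * (2 * M)))) (Real.sqrt (2 * (7 + 6047))) (Real.sqrt (2 * (7 + 6047)))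
      ((fun m' : ℕ => if m' = 1 then |β| / (2 * (2 * M) : ℕ) * kK else if m' = 2 then |U| * |β| / (2 * (2 * M) : ℕ) else 0)) / Real.sqrt (2 * (7 + 6047)) ^ 2 < 1)
    {Br Bc : ℝ} (hBr0 : 0 ≤ Br) (hBc0 : 0 ≤ Bc)
    (hBr : ∀ (ω : Fin (sectorCount 0)) (σ c : Fin 2) (y : SpaceTimeIdx L M),
      ∑ q : GridPoint L (2 * (2 * M)),
        ‖(sectorAnalysisMatrix L M β (klAnisoFamily L M β μ K klE0 0) * hubbardGridSub L M β (2 * (2 * M)))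
          (y, ((ω, σ), c)) ((q, σ), c)‖ ≤ Br)
    (hBc : ∀ (σ c : Fin 2) (q : GridPoint L (2 * (2 * M))),
      ∑ ω : Fin (sectorCount 0), ∑ y : SpaceTimeIdx L M,
        ‖(sectorAnalysisMatrix L M β (klAnisoFamily L M β μ K klE0 0) * hubbardGridSub L M β (2 * (2 * M)))
          (y, ((ω, σ), c)) ((q, σ), c)‖ ≤ Bc)
    {p : ℕ} (hp : 2 ≤ p) :
    klAnisoLegKernelNorm L M β U μ K klE0 0 (2 * p) ≤
      Br * Bc ^ (2 * p - 1) * imagTimeWeight β M ^ (2 * p - 1) *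
        ((Real.sqrt (2 * (7 + 6047)))⁻¹ ^ (2 * p) *
          (Real.exp 1 * ((Real.exp 2 * (Real.sqrt (2 * (7 + 6047)) + Real.sqrt (2 * (7 + 6047)))) ^ (2 * 2) * (|U| * |β| / (2 * (2 * M) : ℕ)))) *
          (Real.exp 1 * α * ((Real.exp 2 * (Real.sqrt (2 * (7 + 6047)) + Real.sqrt (2 * (7 + 6047)))) ^ (2 * 2) * (|U| * |β| / (2 * (2 * M) : ℕ))) / Real.sqrt (2 * (7 + 6047)) ^ 2) ^ (p - 2) /
            (1 - Real.exp 1 * α * normV (GridLeg (GridPoint L (2 * (2 * M)))) (Real.sqrt (2 * (7 + 6047))) (Real.sqrt (2 * (7 + 6047)))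
              ((fun m' : ℕ => if m' = 1 then |β| / (2 * (2 * M) : ℕ) * kK else if m' = 2 then |U| * |β| / (2 * (2 * M) : ℕ) else 0)) / Real.sqrt (2 * (7 + 6047)) ^ 2) ^ p) := by
  have hβpos : 0 < β := lt_of_lt_of_le (by norm_num [klBetaMin]) hβ
  have hκ : 0 < Real.sqrt (2 * (7 + 6047)) := Real.sqrt_pos.2 (by norm_num)
  exact klAnisoLegKernelNorm_zero_le_of_gridStep_bi hβpos U μ K hkK hκ (isGramBoundedR_scaleZero_of_frameOK_sharp hK hβ hβL) hα hrow
    hcol hκ hθ hBr0 hBc0 hBr hBc hp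


/-- **(E1-v4)₀ modulo the decay constant and three symbol numbers**: for every admissible frame (`FrameOK R U N μ K`, `klBetaMin ≤ β ≤ L`),
if the pulled-back scale-`0` covariance has row/column sums `≤ α` with `θ = eα‖Ṽ‖_h/κ₀² < 1`, and the padded scale-`0` multiplier symbols
`G_ω` (`ω` a sector of `klAnisoFamily … klE0 0`) have support `≤ N_s`, time second differences `≤ (4/(s₀·4M))²` and axis second differences
`≤ (4/(s₁L))²`, then for every `p ≥ 2`, with `T := (|β|L²)⁻¹ √(2048(1/s₀+1)[4(2√2/s₁+2)² + 16(1/s₁+1)²]) √(16·4M·L²·N_s)`,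
`klAnisoLegKernelNorm … klE0 0 (2p) ≤ T · (2T)^{2p-1} · (β/(2M))^{2p-1} · (κ₀^{-2p} e‖Ṽ‖_h θ^{p-2}/(1-θ))`. -/
theorem klAnisoLegKernelNorm_zero_le_of_symbol_bounds_bi [NeZero M] {R : RenConsts} {U : ℝ} {N : ℕ} {μ : ℝ} {K : TrigPolyC4v}
    (hK : FrameOK R U N μ K) {β : ℝ} (hβ : klBetaMin ≤ β) (hβL : β ≤ L) {kK : ℝ}
    (hkK : ∑ z : TorusSite 2 L, ‖framePosKernel L K z‖ ≤ kK)
    {α : ℝ} (hα : 0 < α)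
    (hrow : ∀ X, ∑ Y, ‖((hubbardGridSub L M β (2 * (2 * M))).transpose * hubbardCovAboveCT L M β μ 0 K klE0 *
      hubbardGridSub L M β (2 * (2 * M))) X Y‖ ≤ α)
    (hcol : ∀ Y, ∑ X, ‖((hubbardGridSub L M β (2 * (2 * M))).transpose * hubbardCovAboveCT L M β μ 0 K klE0 *
      hubbardGridSub L M β (2 * (2 * M))) X Y‖ ≤ α)
    (hθ : Real.exp 1 * α * normV (GridLeg (GridPoint L (2 * (2 * M)))) (Real.sqrt (2 * (7 + 6047))) (Real.sqrt (2 * (7 + 6047)))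
      (fun m' : ℕ => if m' = 1 then |β| / (2 * (2 * M) : ℕ) * kK else if m' = 2 then |U| * |β| / (2 * (2 * M) : ℕ) else 0) /
        Real.sqrt (2 * (7 + 6047)) ^ 2 < 1)
    {s₀ s₁ : ℝ} (hs₀ : 0 < s₀) (hs₁ : 0 < s₁) {Nsupp : ℕ}
    (hsupp : ∀ ω : Fin (sectorCount 0), (univ.filter fun q : TorusSite 1 (2 * (2 * M)) × TorusSite 2 L =>
      (if h : (q.1 0).val < 2 * M then klAnisoFamily L M β μ K klE0 0 ω (⟨(q.1 0).val, h⟩, q.2) else 0) ≠ 0).card ≤ Nsupp)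
    (h₀ : ∀ (ω : Fin (sectorCount 0)) q, ‖(fwdDiff ((fun _ : Fin 1 => (1 : ZMod (2 * (2 * M)))), (0 : TorusSite 2 L)))^[2]
      (fun q : TorusSite 1 (2 * (2 * M)) × TorusSite 2 L =>
        if h : (q.1 0).val < 2 * M then klAnisoFamily L M β μ K klE0 0 ω (⟨(q.1 0).val, h⟩, q.2) else 0) q‖ ≤
          (4 / (s₀ * (2 * (2 * M) : ℕ))) ^ 2)
    (h₁ : ∀ (ω : Fin (sectorCount 0)) q (i : Fin 2),
      ‖(fwdDiff ((0 : TorusSite 1 (2 * (2 * M))), (Pi.single i (1 : ZMod L) : TorusSite 2 L)))^[2]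
        (fun q : TorusSite 1 (2 * (2 * M)) × TorusSite 2 L =>
          if h : (q.1 0).val < 2 * M then klAnisoFamily L M β μ K klE0 0 ω (⟨(q.1 0).val, h⟩, q.2) else 0) q‖ ≤ (4 / (s₁ * L)) ^ 2)
    {p : ℕ} (hp : 2 ≤ p) :
    klAnisoLegKernelNorm L M β U μ K klE0 0 (2 * p) ≤
      (1 / (|β| * (L : ℝ) ^ 2) *
        (Real.sqrt (2048 * (1 / s₀ + 1) *
            (4 * ((2 * Real.sqrt 2 / s₁ + 2) * (2 * Real.sqrt 2 / s₁ + 2)) + 16 * (1 / s₁ + 1) ^ 2)) *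
          Real.sqrt (16 * (2 * (2 * M) : ℕ) * (L : ℝ) ^ 2 * Nsupp))) *
      (2 * (1 / (|β| * (L : ℝ) ^ 2) *
        (Real.sqrt (2048 * (1 / s₀ + 1) *
            (4 * ((2 * Real.sqrt 2 / s₁ + 2) * (2 * Real.sqrt 2 / s₁ + 2)) + 16 * (1 / s₁ + 1) ^ 2)) *
          Real.sqrt (16 * (2 * (2 * M) : ℕ) * (L : ℝ) ^ 2 * Nsupp)))) ^ (2 * p - 1) *
      imagTimeWeight β M ^ (2 * p - 1) *
        ((Real.sqrt (2 * (7 + 6047)))⁻¹ ^ (2 * p) *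
          (Real.exp 1 * ((Real.exp 2 * (Real.sqrt (2 * (7 + 6047)) + Real.sqrt (2 * (7 + 6047)))) ^ (2 * 2) * (|U| * |β| / (2 * (2 * M) : ℕ)))) *
          (Real.exp 1 * α * ((Real.exp 2 * (Real.sqrt (2 * (7 + 6047)) + Real.sqrt (2 * (7 + 6047)))) ^ (2 * 2) * (|U| * |β| / (2 * (2 * M) : ℕ))) / Real.sqrt (2 * (7 + 6047)) ^ 2) ^ (p - 2) /
            (1 - Real.exp 1 * α * normV (GridLeg (GridPoint L (2 * (2 * M)))) (Real.sqrt (2 * (7 + 6047))) (Real.sqrt (2 * (7 + 6047)))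
              ((fun m' : ℕ => if m' = 1 then |β| / (2 * (2 * M) : ℕ) * kK else if m' = 2 then |U| * |β| / (2 * (2 * M) : ℕ) else 0)) /
                Real.sqrt (2 * (7 + 6047)) ^ 2) ^ p) := by
  have hβpos : 0 < β := lt_of_lt_of_le (by norm_num [klBetaMin]) hβ
  set T : ℝ := 1 / (|β| * (L : ℝ) ^ 2) *
        (Real.sqrt (2048 * (1 / s₀ + 1) *
            (4 * ((2 * Real.sqrt 2 / s₁ + 2) * (2 * Real.sqrt 2 / s₁ + 2)) + 16 * (1 / s₁ + 1) ^ 2)) *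
          Real.sqrt (16 * (2 * (2 * M) : ℕ) * (L : ℝ) ^ 2 * Nsupp)) with hT
  have hT0 : 0 ≤ T := by rw [hT]; positivity
  -- the product-torus bound for the scale-0 family
  have htorus := torusSum_le_of_symbol_bounds β (klAnisoFamily L M β μ K klE0 0) (conj_klAnisoFamily β μ K klE0 0)
    (fun ω k => norm_bgmMultiplier_le_one klE0 β _ 0 ω k) hs₀ hs₁ hsupp h₀ h₁
  have hBr := rowSum_sectorAnalysis_mul_hubbardGridSub_le_of_torusSum hβpos.ne' (klAnisoFamily L M β μ K klE0 0) (T := T) htorus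
  have hBc := colSum_sectorAnalysis_mul_hubbardGridSub_le_of_torusSum hβpos.ne' (klAnisoFamily L M β μ K klE0 0) (T := T) htorus
  have h2T : ((sectorCount 0 : ℕ) : ℝ) * T = 2 * T := by rw [sectorCount_zero]; norm_num
  rw [h2T] at hBc
  exact klAnisoLegKernelNorm_zero_le_of_frameOK_bi hK hβ hβL hkK hα hrow hcol hθ hT0 (by positivity)
    (fun ω σ c y => hBr ω σ c y) (fun σ c q => hBc σ c q) hp


end Summit.HubbardSuperconductivity.HubbardSuperconductivity.Theorems.EngineV8

end
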